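import Literature.AlgebraicGeometry.HodgeTheory.BettiKunnethPieceCorrespondenceRepresentationRank
import Literature.AlgebraicGeometry.HodgeTheory.BettiHodgeConjectureProductsWithSurfaceUnconditional
import HarnessLib

/-!
# `HC(S × S')` for two arbitrary smooth projective surfaces iff the morphisms of Hodge structures `H²(S') → H²(S)` are accounted for by algebraic correspondences: the Künneth component of an
# algebraic class is algebraic whenever the OTHER pieces carry only algebraic Hodge classes (abstract form), the pieces `H⁰⊗H⁴`, `H¹⊗H³`, `H³⊗H¹`, `H⁴⊗H⁰` of `H⁴(S × S')` do so, and the numeric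
# criterion `dim_ℚ Hom_HS(H²S, H²S') ≤ dim_ℂ ⟨algebraic actions H²(S';ℂ) → H²(S;ℂ)⟩`; surface × threefold
# (Voisin I §11.3.3 Thm. 11.38–11.40, Lemma 11.41, p. 287, §6.2.3 Thm. 6.25, §11.3.1 Thm. 11.30; Voisin II Prop. 9.20, (10.7); Voisin 2013 Lemma 2.1; Deligne 2000 §1)

Family `hodge`, lane `lit-hodgefound` (Track 2 foundations library; Layers A1/A4), layer `Literature/AlgebraicGeometry/HodgeTheory`.  THEOREMS ONLY (no definition, no named fact, no instance;
D-0026 net debt `0`).  The seat's g30-#1/#3/#4 isolate the Künneth component of an algebraic class on `Y × Z` under the hypothesis that one factor is OFF-MIDDLE ALGEBRAIC; what the argument really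
uses is that the Hodge classes of the OTHER Künneth pieces of `H^{2c}(Y × Z)` have algebraic cross products.  §1 states the component lemma and its corollaries (read-off, span form, numeric criterion)
in that abstract form.  §2 applies it to two smooth projective SURFACES `S`, `S'` of ANY irregularity and geometric genus: in `H⁴(S × S')` the pieces `H⁰(S) ⊗ H⁴(S')`, `H⁴(S) ⊗ H⁰(S')` (points and
fundamental classes) and `H¹(S) ⊗ H³(S')`, `H³(S) ⊗ H¹(S')` (the seat's g29-#1: hard Lefschetz on the surface, Lefschetz `(1,1)`, cup products of divisors) carry only algebraic Hodge classes, and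
`HC(S × S') ⟺` the piece `H²(S) ⊗ H²(S')` is algebraic (g29-#1 §2).  Hence **`HC(S × S')` iff every Hodge class of `H²(S) ⊗ H²(S')` — by Lemma 11.41 a morphism of Hodge structures `H²(S') → H²(S)` —
acts on `H²(S';ℂ)` as some rational algebraic class of `H⁴(S × S')` does, iff `dim_ℚ Hom_HS(H²S, H²S') ≤ dim_ℂ ⟨(γ ⊗ 1)_* : γ ∈ H⁴(S × S';ℚ), γ ⊗ 1 ∈ N²⟩`** — the classical reading «the Hodge
conjecture for `S × S'` amounts to the algebraicity of the Hodge classes in `H²(S) ⊗ H²(S')`, i.e. of the morphisms of Hodge structures between the second cohomologies (for K3 surfaces: of the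
isogenies)».  §3 treats `S × T` for a threefold `T` with `Hom_HS(H¹S, H³T(1)) = 0`.

WHAT IS PROVED.
* §1 (any `Y`, `Z`; hypothesis `hother`: the Hodge classes of the pieces `(i', j') ≠ (i, j)` of `H^{2c}(Y × Z)` have algebraic cross products)
  **`BettiUniverse.exists_kunneth_algebraic_corrAction_eq_of_forall_ne`** (component of an algebraic class: Hodge, algebraic, same action on `Hᵃ(Z;ℂ)`, `a + 2c = i + 2n`),
  **`BettiUniverse.ofRatClass_crossMap_mem_algebraicClasses_of_corrAction_eq_of_forall_ne`** (read-off), **`…_of_corrAction_mem_span_of_forall_ne`** (span form),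
  **`BettiUniverse.kunneth_piece_algebraic_iff_finrank_le_of_forall_ne`** (numeric: piece algebraic ⟺ `dim_ℚ Hdgᶜ(HⁱY ⊗ HʲZ) ≤ dim_ℂ AS`).
* §2 SURFACES.  **`BettiUniverse.kunneth_surfaces_ne_two_two_algebraic`** (`hother` for `(2,2)` on `S × S'`), **`BettiUniverse.exists_kunneth_two_two_algebraic_corrAction_eq`**,
  **`BettiUniverse.hodgeConjectureFor_tensor_surfaces_iff_forall_exists_corrAction_eq`**, **`BettiUniverse.hodgeConjectureFor_tensor_surfaces_iff_finrank_hom_le_finrank_span`**,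
  **`BettiUniverse.hodgeConjectureFor_tensor_surfaces_of_linearIndependent_corrAction`** (`|ι|` algebraic correspondences with ℂ-independent actions on `H²(S';ℂ)` and `dim_ℚ Hom_HS(H²S, H²S') ≤ |ι|`
  ⇒ `HC(S × S')`; g29-#4 §3 was the case `{NS ⊗ NS', Δ}`), **`BettiUniverse.hodgeConjectureFor_tensor_self_surface_iff_finrank_end_le_finrank_span`** (`HC(S × S) ⟺ dim_ℚ End_HS(H²S) ≤ dim_ℂ AS`).
* §3 **`BettiUniverse.hodgeConjectureFor_surface_tensor_threefold_iff_finrank_hom_le_finrank_span_of_hom_one_three`**: `S × T`, `Hom_HS(H¹S, H³T(1)) = 0`: `HC(S × T) ⟺ dim_ℚ Hom_HS(H²S, H²T) ≤ dim_ℂ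
  ⟨actions H⁴(T;ℂ) → H²(S;ℂ) of the algebraic classes of H⁴(S × T)⟩`.

THE PRINTS.  C. Voisin (2002) [VoisinHodgeI2002] §6.2.3 Thm. 6.25; §11.1.2 Prop. 11.20; §11.3.1 Thm. 11.30; §11.3.3 Thm. 11.38–11.40, Lemma 11.41 and pp. 286–287.  C. Voisin (2003) [VoisinHodgeII2003] §9.2.4 Prop. 9.20;
§10.2.2 proof of Thm. 10.17, (10.7).  C. Voisin (2013) [Voisin2013GHCBloch] Lemma 2.1.  C. Voisin (2025) [Voisin2025] §3.2.1 (12)–(14), Prop. 3.8, Cor. 3.9.  P. Deligne (2000/2006) [Deligne2000] §1.  A. Hatcher (2002)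
[HatcherAT2002] §3.1 p. 198, §3.3 Prop. 3.38.

THE OBJECTS (all the tree's).  `corrAction μ hY hZ hab`, `kunnethPiece`, `BettiUniverse.crossMap`, `BettiUniverse.kunnethSummand`, `BettiUniverse.hodge hHD hX k`, `hodgeClasses`, `HodgeStructure.Hom`, `tensor`,
`tateTwist`, `cast`, `bettiCohomology`, `complexBetti`, `ofRatClass`, `algebraicClasses`, `HodgeConjectureFor`; `hodgeConjectureFor_of_dim_le_three_holds` (`HC` in dimension `≤ 3`, tree theorem).

DEVIATIONS / SCOPE.  Which algebraic correspondences `S ⊢ S'` exist (isogenies of K3 surfaces, …) is the geometry of the pair and is not discussed.  No definitions.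

## References
* [VoisinHodgeI2002] C. Voisin, *Hodge Theory and Complex Algebraic Geometry I* (2002) — §6.2.3 Thm. 6.25; §11.1.2 Prop. 11.20; §11.3.1 Thm. 11.30; §11.3.3 Thm. 11.38, Thm. 11.40, Lemma 11.41, pp. 286–287.
* [VoisinHodgeII2003] C. Voisin, *Hodge Theory and Complex Algebraic Geometry II* (2003) — §9.2.4 Prop. 9.20; §10.2.2 proof of Thm. 10.17 (10.7).
* [Voisin2013GHCBloch] C. Voisin, *The generalized Hodge and Bloch conjectures are equivalent for general complete intersections* (2013) — Lemma 2.1.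
* [Voisin2025] C. Voisin, *Cycle classes on algebraic varieties* (2025) — §3.2.1 (12)–(14), Prop. 3.8, Cor. 3.9.
* [Deligne2000] P. Deligne, *The Hodge conjecture* (Clay problem description) — §1.
* [HatcherAT2002] A. Hatcher, *Algebraic Topology* (2002) — §3.1 p. 198; §3.3 Prop. 3.38.

## Provenance
Lane `lit-hodgefound` (Hodge path, Track 2), prover seat `lit-hodgefound-p29` (generation 30), self-proposed row g30-#5 (g30-#1/#3/#4 with «off-middle algebraic» replaced by «the other pieces are algebraic»,
read on two surfaces).
-/

noncomputable section

open scoped TensorProduct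
open CategoryTheory MonoidalCategory CartesianMonoidalCategory Module Finset
open Literature.AlgebraicTopology.SingularHomology
open Literature.Geometry.Kaehler

namespace Literature.AlgebraicGeometry.HodgeTheory

open Literature.AlgebraicGeometry.Motives
open Literature.AlgebraicGeometry.Motives.HodgeStructure

variable {m n d : ℕ} {X Y Z S S' T : SchemeOver ℂ}

/-! ### §0 Plumbing -/

/-- `(q • a) ⊗ 1 = q • (a ⊗ 1)` for the lattice map `Hᵏ(Y;ℚ) → Hᵏ(Y;ℂ)` (private copy of the tree's file-local lemma). [cite: HatcherAT2002, §3.1 p. 198] -/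
private theorem ofRatClass_rat_smul' {T : Type} [TopologicalSpace T] {k : ℕ} (q : ℚ) (a : singularCohomology ℚ ℚ T k) :
    ofRatClass T k (q • a) = (q : ℂ) • ofRatClass T k a := by
  rw [ofRatClass, coeffClass_smul, smul_coeffClass]
  refine coeffClass_congr (fun x ↦ ?_) a
  simp

/-- The space of ℂ-linear maps `Hᵃ(Z;ℂ) → Hⁱ(Y;ℂ)` is finite-dimensional. [cite: VoisinHodgeI2002, §7.1.1] -/
private theorem finite_hom_complexBetti (hY : IsSmoothProjective m Y) (hZ : IsSmoothProjective n Z) (i a : ℕ) : Module.Finite ℂ (complexBetti Z a →ₗ[ℂ] complexBetti Y i) := by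
  haveI := finite_complexBetti hZ a
  haveI := finite_complexBetti hY i
  infer_instance

/-! ### §1 The component lemma when the other pieces are algebraic -/

section Abstract

variable [HodgeTensorFacts.{0, 0}] (μ : OrientationFamily)

/-- **The `(i, j)`-component of an algebraic class is algebraic when the other pieces are.**  Let `Y` (dimension `m`), `Z` (dimension `n`) be smooth projective, `i + j = 2c`, `a + 2c = i + 2n`, and suppose
that for every `(i', j') ≠ (i, j)` with `i' + j' = 2c` the Hodge classes of the summand `H^{i'}(Y) ⊗ H^{j'}(Z)` have algebraic cross products.  Then for every `γ ∈ H^{2c}(Y × Z;ℚ)` with `γ ⊗ 1` algebraic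
there is a Hodge class `t` of `Hⁱ(Y) ⊗ Hʲ(Z)` with `crossMap t ⊗ 1` ALGEBRAIC and `(crossMap t ⊗ 1)_* = (γ ⊗ 1)_*` on `Hᵃ(Z;ℂ)` (`γ ⊗ 1` is a Hodge class, Prop. 11.20; Thm. 11.38/11.40; Cor. 3.9; the other
pieces act by zero on `Hᵃ(Z;ℂ)`, g30-#1 §1). [cite: VoisinHodgeI2002, §11.1.2 Prop. 11.20, §11.3.3 Thm. 11.38–11.40 and pp. 286–287] [cite: Voisin2025, §3.2.1 (12)–(14), Prop. 3.8 and Cor. 3.9] -/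
theorem BettiUniverse.exists_kunneth_algebraic_corrAction_eq_of_forall_ne (hHD : exists_isReal_hodgeModel) (hY : IsSmoothProjective m Y) (hZ : IsSmoothProjective n Z) {c i j a : ℕ}
    (hij : i + j = 2 * c) (hab : a + 2 * c = i + 2 * n)
    (hother : ∀ (i' j' : ℕ) (hij' : i' + j' = 2 * c), (i', j') ≠ (i, j) →
      ∀ u ∈ (BettiUniverse.kunnethSummand hHD hY hZ (2 * c) ⟨(i', j'), HasAntidiagonal.mem_antidiagonal.2 hij'⟩).hodgeClasses c,
        ofRatClass (ComplexPoints (Y ⊗ Z)) (2 * c) (BettiUniverse.crossMap Y Z hij' u) ∈ algebraicClasses (Y ⊗ Z) c)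
    {γ : bettiCohomology (Y ⊗ Z) (2 * c)} (hγ : ofRatClass (ComplexPoints (Y ⊗ Z)) (2 * c) γ ∈ algebraicClasses (Y ⊗ Z) c) :
    ∃ t ∈ (BettiUniverse.kunnethSummand hHD hY hZ (2 * c) ⟨(i, j), HasAntidiagonal.mem_antidiagonal.2 hij⟩).hodgeClasses c,
      ofRatClass (ComplexPoints (Y ⊗ Z)) (2 * c) (BettiUniverse.crossMap Y Z hij t) ∈ algebraicClasses (Y ⊗ Z) c ∧
      corrAction μ hY hZ hab (ofRatClass (ComplexPoints (Y ⊗ Z)) (2 * c) (BettiUniverse.crossMap Y Z hij t)) = corrAction μ hY hZ hab (ofRatClass (ComplexPoints (Y ⊗ Z)) (2 * c) γ) := by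
  classical
  obtain ⟨t, ht, hsum, hact⟩ := BettiUniverse.exists_kunneth_family_corrAction_eq μ hHD hY hZ (hY.tensor_holds hZ) hij hab
    (BettiUniverse.mem_hodgeClasses_hodge_tensor_of_mem_algebraicClasses hHD hY hZ hγ)
  set inn : ↥(antidiagonal (2 * c)) := ⟨(i, j), HasAntidiagonal.mem_antidiagonal.2 hij⟩ with hinn
  have hothers : ∀ ij ∈ univ.erase inn, (ij.1.1, ij.1.2) ≠ (i, j) := by
    intro ij hij' h
    exact (Finset.mem_erase.1 hij').1 (Subtype.ext h)
  refine ⟨t inn, ht inn, ?_, hact⟩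
  have e : ofRatClass (ComplexPoints (Y ⊗ Z)) (2 * c) (BettiUniverse.crossMap Y Z hij (t inn)) =
      ofRatClass (ComplexPoints (Y ⊗ Z)) (2 * c) γ - ∑ ij ∈ univ.erase inn, ofRatClass (ComplexPoints (Y ⊗ Z)) (2 * c) (BettiUniverse.crossMap Y Z (mem_antidiagonal.1 ij.2) (t ij)) := by
    rw [hsum, map_sum, ← Finset.add_sum_erase univ _ (Finset.mem_univ inn), add_sub_cancel_right]
  rw [e]
  refine Submodule.sub_mem _ hγ (Submodule.sum_mem _ fun ij hij' ↦ ?_)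
  obtain ⟨⟨i', j'⟩, hij2⟩ := ij
  exact hother i' j' (mem_antidiagonal.1 hij2) (hothers _ hij') (t ⟨(i', j'), hij2⟩) (ht ⟨(i', j'), hij2⟩)

/-- **Read-off**: under `hother`, a class `t ∈ Hⁱ(Y;ℚ) ⊗ Hʲ(Z;ℚ)` has algebraic `crossMap t ⊗ 1` as soon as some rational algebraic `γ` acts on `Hᵃ(Z;ℂ)` (`a + j = 2n`) as `t` does (the component of `γ` IS `t`,
g30-#2 §3). [cite: VoisinHodgeI2002, §11.3.3 Thm. 11.38–11.40, Lemma 11.41 and pp. 286–287] [cite: Voisin2025, §3.2.1 (12)–(14), Prop. 3.8 and Cor. 3.9] -/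
theorem BettiUniverse.ofRatClass_crossMap_mem_algebraicClasses_of_corrAction_eq_of_forall_ne (hHD : exists_isReal_hodgeModel) (hY : IsSmoothProjective m Y) (hZ : IsSmoothProjective n Z)
    {c i j a : ℕ} (hij : i + j = 2 * c) (haj : a + j = 2 * n) (hab : a + 2 * c = i + 2 * n)
    (hother : ∀ (i' j' : ℕ) (hij' : i' + j' = 2 * c), (i', j') ≠ (i, j) →
      ∀ u ∈ (BettiUniverse.kunnethSummand hHD hY hZ (2 * c) ⟨(i', j'), HasAntidiagonal.mem_antidiagonal.2 hij'⟩).hodgeClasses c,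
        ofRatClass (ComplexPoints (Y ⊗ Z)) (2 * c) (BettiUniverse.crossMap Y Z hij' u) ∈ algebraicClasses (Y ⊗ Z) c)
    {t : bettiCohomology Y i ⊗[ℚ] bettiCohomology Z j} {γ : bettiCohomology (Y ⊗ Z) (2 * c)} (hγ : ofRatClass (ComplexPoints (Y ⊗ Z)) (2 * c) γ ∈ algebraicClasses (Y ⊗ Z) c)
    (hact : corrAction μ hY hZ hab (ofRatClass (ComplexPoints (Y ⊗ Z)) (2 * c) γ) = corrAction μ hY hZ hab (ofRatClass (ComplexPoints (Y ⊗ Z)) (2 * c) (BettiUniverse.crossMap Y Z hij t))) :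
    ofRatClass (ComplexPoints (Y ⊗ Z)) (2 * c) (BettiUniverse.crossMap Y Z hij t) ∈ algebraicClasses (Y ⊗ Z) c := by
  obtain ⟨t', -, halg, hact'⟩ := BettiUniverse.exists_kunneth_algebraic_corrAction_eq_of_forall_ne μ hHD hY hZ hij hab hother hγ
  obtain rfl : t = t' := BettiUniverse.corrAction_crossMap_injective μ hY hZ hij haj hab (hact.symm.trans hact'.symm)
  exact halg

/-- **Span form**: under `hother`, `crossMap t ⊗ 1` is algebraic as soon as the action of `t` on `Hᵃ(Z;ℂ)` lies in the ℂ-span of the actions of the rational algebraic classes of `H^{2c}(Y × Z)` (the span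
consists of actions of complex algebraic classes of the piece; injectivity on the complex piece, g30-#2 §2). [cite: VoisinHodgeI2002, §11.3.3 Thm. 11.38–11.40, Lemma 11.41 and pp. 286–287]
[cite: Voisin2025, §3.2.1 (12)–(14), Prop. 3.8 and Cor. 3.9] [cite: HatcherAT2002, §3.3 Prop. 3.38] -/
theorem BettiUniverse.ofRatClass_crossMap_mem_algebraicClasses_of_corrAction_mem_span_of_forall_ne (hHD : exists_isReal_hodgeModel) (hY : IsSmoothProjective m Y) (hZ : IsSmoothProjective n Z)
    {c i j a : ℕ} (hij : i + j = 2 * c) (haj : a + j = 2 * n) (hab : a + 2 * c = i + 2 * n)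
    (hother : ∀ (i' j' : ℕ) (hij' : i' + j' = 2 * c), (i', j') ≠ (i, j) →
      ∀ u ∈ (BettiUniverse.kunnethSummand hHD hY hZ (2 * c) ⟨(i', j'), HasAntidiagonal.mem_antidiagonal.2 hij'⟩).hodgeClasses c,
        ofRatClass (ComplexPoints (Y ⊗ Z)) (2 * c) (BettiUniverse.crossMap Y Z hij' u) ∈ algebraicClasses (Y ⊗ Z) c)
    {t : bettiCohomology Y i ⊗[ℚ] bettiCohomology Z j}
    (ht : corrAction μ hY hZ hab (ofRatClass (ComplexPoints (Y ⊗ Z)) (2 * c) (BettiUniverse.crossMap Y Z hij t)) ∈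
      Submodule.span ℂ ((fun γ ↦ corrAction μ hY hZ hab (ofRatClass (ComplexPoints (Y ⊗ Z)) (2 * c) γ)) ''
        {γ : bettiCohomology (Y ⊗ Z) (2 * c) | ofRatClass (ComplexPoints (Y ⊗ Z)) (2 * c) γ ∈ algebraicClasses (Y ⊗ Z) c})) :
    ofRatClass (ComplexPoints (Y ⊗ Z)) (2 * c) (BettiUniverse.crossMap Y Z hij t) ∈ algebraicClasses (Y ⊗ Z) c := by
  -- the span consists of actions of complex algebraic classes of the piece
  have key : ∀ f ∈ Submodule.span ℂ ((fun γ ↦ corrAction μ hY hZ hab (ofRatClass (ComplexPoints (Y ⊗ Z)) (2 * c) γ)) ''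
      {γ : bettiCohomology (Y ⊗ Z) (2 * c) | ofRatClass (ComplexPoints (Y ⊗ Z)) (2 * c) γ ∈ algebraicClasses (Y ⊗ Z) c}),
      ∃ x ∈ kunnethPiece Y Z hij, x ∈ algebraicClasses (Y ⊗ Z) c ∧ corrAction μ hY hZ hab x = f := by
    intro f hf
    induction hf using Submodule.span_induction with
    | mem g hg =>
      obtain ⟨γ, hγ, rfl⟩ := hg
      obtain ⟨t', -, halg, hact⟩ := BettiUniverse.exists_kunneth_algebraic_corrAction_eq_of_forall_ne μ hHD hY hZ hij hab hother hγ
      exact ⟨_, ofRatClass_crossMap_mem_kunnethPiece hij t', halg, hact⟩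
    | zero => exact ⟨0, Submodule.zero_mem _, Submodule.zero_mem _, map_zero _⟩
    | add g g' _ _ hg hg' =>
      obtain ⟨x, hx, hxa, rfl⟩ := hg
      obtain ⟨x', hx', hxa', rfl⟩ := hg'
      exact ⟨x + x', Submodule.add_mem _ hx hx', Submodule.add_mem _ hxa hxa', map_add _ _ _⟩
    | smul s g _ hg =>
      obtain ⟨x, hx, hxa, rfl⟩ := hg
      exact ⟨s • x, Submodule.smul_mem _ _ hx, Submodule.smul_mem _ _ hxa, map_smul _ _ _⟩
  obtain ⟨x, hx, hxa, hact⟩ := key _ ht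
  rw [eq_of_mem_kunnethPiece_of_corrAction_eq μ hY hZ hij haj hab (ofRatClass_crossMap_mem_kunnethPiece hij t) hx hact.symm]
  exact hxa

/-- **Numeric criterion under `hother`: the piece `Hⁱ(Y) ⊗ Hʲ(Z)` is algebraic iff `dim_ℚ Hdgᶜ(HⁱY ⊗ HʲZ) ≤ dim_ℂ ⟨actions on Hᵃ(Z;ℂ) of the rational algebraic classes of H^{2c}(Y × Z)⟩`** (the algebraic span lies in the
Hodge span, of dimension `dim_ℚ Hdgᶜ(HⁱY ⊗ HʲZ)` by g30-#4 §1). [cite: VoisinHodgeI2002, §11.3.3 Thm. 11.38–11.40, Lemma 11.41 and pp. 286–287] [cite: Voisin2025, §3.2.1 (12)–(14), Prop. 3.8 and Cor. 3.9] -/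
theorem BettiUniverse.kunneth_piece_algebraic_iff_finrank_le_of_forall_ne (hHD : exists_isReal_hodgeModel) (hY : IsSmoothProjective m Y) (hZ : IsSmoothProjective n Z) {c i j a : ℕ}
    (hij : i + j = 2 * c) (haj : a + j = 2 * n) (hab : a + 2 * c = i + 2 * n)
    (hother : ∀ (i' j' : ℕ) (hij' : i' + j' = 2 * c), (i', j') ≠ (i, j) →
      ∀ u ∈ (BettiUniverse.kunnethSummand hHD hY hZ (2 * c) ⟨(i', j'), HasAntidiagonal.mem_antidiagonal.2 hij'⟩).hodgeClasses c,
        ofRatClass (ComplexPoints (Y ⊗ Z)) (2 * c) (BettiUniverse.crossMap Y Z hij' u) ∈ algebraicClasses (Y ⊗ Z) c) :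
    (∀ t ∈ (BettiUniverse.kunnethSummand hHD hY hZ (2 * c) ⟨(i, j), HasAntidiagonal.mem_antidiagonal.2 hij⟩).hodgeClasses c,
        ofRatClass (ComplexPoints (Y ⊗ Z)) (2 * c) (BettiUniverse.crossMap Y Z hij t) ∈ algebraicClasses (Y ⊗ Z) c) ↔
      Module.finrank ℚ ↥(((BettiUniverse.hodge hHD hY i).tensor (BettiUniverse.hodge hHD hZ j)).hodgeClasses c) ≤
        Module.finrank ℂ ↥(Submodule.span ℂ ((fun γ ↦ corrAction μ hY hZ hab (ofRatClass (ComplexPoints (Y ⊗ Z)) (2 * c) γ)) ''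
          {γ : bettiCohomology (Y ⊗ Z) (2 * c) | ofRatClass (ComplexPoints (Y ⊗ Z)) (2 * c) γ ∈ algebraicClasses (Y ⊗ Z) c})) := by
  haveI := finite_hom_complexBetti hY hZ i a
  have hYZ := hY.tensor_holds hZ
  have hAS := BettiUniverse.span_corrAction_algebraic_le_span_corrAction_hodgeClasses μ hHD hY hZ hYZ (c := c) hab
  have hdim := BettiUniverse.finrank_span_corrAction_hodgeClasses_eq μ hHD hY hZ hYZ hij haj hab
  constructor
  · intro halg
    rw [← hdim]
    exact Submodule.finrank_mono (BettiUniverse.span_corrAction_hodgeClasses_le_span_corrAction_algebraic_of_forall μ hHD hY hZ hYZ hij hab halg)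
  · intro hle t ht
    rw [← hdim] at hle
    have heq := Submodule.eq_of_le_of_finrank_le hAS hle
    refine BettiUniverse.ofRatClass_crossMap_mem_algebraicClasses_of_corrAction_mem_span_of_forall_ne μ hHD hY hZ hij haj hab hother ?_
    rw [heq]
    exact Submodule.subset_span ⟨_, BettiUniverse.crossMap_mem_hodgeClasses hHD hodgePQ_independent_of_hodgeModel_holds hY hZ hYZ hij c ht, rfl⟩

/-- **Family form under `hother`**: `|ι|` rational algebraic classes with ℂ-linearly independent actions on `Hᵃ(Z;ℂ)` and `dim_ℚ Hdgᶜ(HⁱY ⊗ HʲZ) ≤ |ι|` ⇒ the piece is algebraic.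
[cite: VoisinHodgeI2002, §11.3.3 Thm. 11.38–11.40, Lemma 11.41 and pp. 286–287] [cite: Voisin2025, §3.2.1 (12)–(14), Prop. 3.8 and Cor. 3.9] -/
theorem BettiUniverse.kunneth_piece_algebraic_of_linearIndependent_corrAction_of_forall_ne {ι : Type} [Fintype ι] (hHD : exists_isReal_hodgeModel) (hY : IsSmoothProjective m Y)
    (hZ : IsSmoothProjective n Z) {c i j a : ℕ} (hij : i + j = 2 * c) (haj : a + j = 2 * n) (hab : a + 2 * c = i + 2 * n)
    (hother : ∀ (i' j' : ℕ) (hij' : i' + j' = 2 * c), (i', j') ≠ (i, j) →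
      ∀ u ∈ (BettiUniverse.kunnethSummand hHD hY hZ (2 * c) ⟨(i', j'), HasAntidiagonal.mem_antidiagonal.2 hij'⟩).hodgeClasses c,
        ofRatClass (ComplexPoints (Y ⊗ Z)) (2 * c) (BettiUniverse.crossMap Y Z hij' u) ∈ algebraicClasses (Y ⊗ Z) c)
    (γ : ι → bettiCohomology (Y ⊗ Z) (2 * c)) (hγ : ∀ k, ofRatClass (ComplexPoints (Y ⊗ Z)) (2 * c) (γ k) ∈ algebraicClasses (Y ⊗ Z) c)
    (hind : LinearIndependent ℂ fun k ↦ corrAction μ hY hZ hab (ofRatClass (ComplexPoints (Y ⊗ Z)) (2 * c) (γ k)))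
    (hle : Module.finrank ℚ ↥(((BettiUniverse.hodge hHD hY i).tensor (BettiUniverse.hodge hHD hZ j)).hodgeClasses c) ≤ Fintype.card ι) :
    ∀ t ∈ (BettiUniverse.kunnethSummand hHD hY hZ (2 * c) ⟨(i, j), HasAntidiagonal.mem_antidiagonal.2 hij⟩).hodgeClasses c,
      ofRatClass (ComplexPoints (Y ⊗ Z)) (2 * c) (BettiUniverse.crossMap Y Z hij t) ∈ algebraicClasses (Y ⊗ Z) c := by
  haveI := finite_hom_complexBetti hY hZ i a
  refine (BettiUniverse.kunneth_piece_algebraic_iff_finrank_le_of_forall_ne μ hHD hY hZ hij haj hab hother).2 (hle.trans ?_)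
  have hsub : Submodule.span ℂ (Set.range fun k ↦ corrAction μ hY hZ hab (ofRatClass (ComplexPoints (Y ⊗ Z)) (2 * c) (γ k))) ≤
      Submodule.span ℂ ((fun γ ↦ corrAction μ hY hZ hab (ofRatClass (ComplexPoints (Y ⊗ Z)) (2 * c) γ)) ''
        {γ : bettiCohomology (Y ⊗ Z) (2 * c) | ofRatClass (ComplexPoints (Y ⊗ Z)) (2 * c) γ ∈ algebraicClasses (Y ⊗ Z) c}) :=
    Submodule.span_mono (Set.range_subset_iff.2 fun k ↦ ⟨γ k, hγ k, rfl⟩)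
  refine le_trans ?_ (Submodule.finrank_mono hsub)
  rw [finrank_span_eq_card hind]

end Abstract

/-! ### §2 Two smooth projective surfaces -/

section Surfaces

variable [HodgeTensorFacts.{0, 0}] (μ : OrientationFamily)

/-- **On `S × S'` (two smooth projective surfaces) the Künneth pieces of `H⁴` other than `H²(S) ⊗ H²(S')` carry only algebraic Hodge classes**: `H⁰(S) ⊗ H⁴(S')` and `H⁴(S) ⊗ H⁰(S')` (pure factor `H⁰`,
and `HC²` of a surface: points), `H¹(S) ⊗ H³(S')` and `H³(S) ⊗ H¹(S')` (hard Lefschetz on the surface, Lefschetz `(1,1)`, cup products of divisor classes — the seat's g29-#1 §1).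
[cite: VoisinHodgeI2002, §6.2.3 Thm. 6.25, §11.3.1 Thm. 11.30, §11.3.3 Thm. 11.38–11.40 and p. 287] [cite: VoisinHodgeII2003, §9.2.4 Prop. 9.20] [cite: Voisin2013GHCBloch, Lemma 2.1] -/
theorem BettiUniverse.kunneth_surfaces_ne_two_two_algebraic (hHD : exists_isReal_hodgeModel) (hS : IsSmoothProjective 2 S) (hS' : IsSmoothProjective 2 S') (i' j' : ℕ) (hij' : i' + j' = 2 * 2)
    (hne : (i', j') ≠ (2, 2)) :
    ∀ u ∈ (BettiUniverse.kunnethSummand hHD hS hS' (2 * 2) ⟨(i', j'), HasAntidiagonal.mem_antidiagonal.2 hij'⟩).hodgeClasses 2,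
      ofRatClass (ComplexPoints (S ⊗ S')) (2 * 2) (BettiUniverse.crossMap S S' hij' u) ∈ algebraicClasses (S ⊗ S') 2 := by
  intro u hu
  have hSS' : IsSmoothProjective 4 (S ⊗ S') := hS.tensor_holds hS'
  have hHCS : HodgeConjectureFor 2 S := hodgeConjectureFor_of_dim_le_three_holds (by norm_num) hS
  have hHCS' : HodgeConjectureFor 2 S' := hodgeConjectureFor_of_dim_le_three_holds (by norm_num) hS'
  have hi' : i' ≤ 4 := by omega
  interval_cases i'
  · obtain rfl : j' = 4 := by omega
    exact BettiUniverse.ofRatClass_crossMap_mem_algebraicClasses_of_fst_zero hHD hS hS' hij'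
      (fun z hz ↦ hHCS'.2 2 _ (isRationalClass_ofRatClass _) ((BettiUniverse.mem_hodgeClasses_hodge_iff_isOfHodgeType hHD hS' 2 z).1 hz)) hu
  · obtain rfl : j' = 3 := by omega
    exact BettiUniverse.ofRatClass_crossMap_mem_algebraicClasses_of_mem_hodgeClasses_one_three hHD hS hS' hSS' hu
  · obtain rfl : j' = 2 := by omega
    exact absurd rfl hne
  · obtain rfl : j' = 1 := by omega
    exact BettiUniverse.ofRatClass_crossMap_mem_algebraicClasses_of_mem_hodgeClasses_three_one hHD hS hS' hSS' hu
  · obtain rfl : j' = 0 := by omega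
    exact BettiUniverse.ofRatClass_crossMap_mem_algebraicClasses_of_snd_zero hHD hS hS' hij'
      (fun y hy ↦ hHCS.2 2 _ (isRationalClass_ofRatClass _) ((BettiUniverse.mem_hodgeClasses_hodge_iff_isOfHodgeType hHD hS 2 y).1 hy)) hu

/-- **The `(2,2)`-component of an algebraic class on `S × S'` is algebraic and acts on `H²(S';ℂ)` as the class**: for two smooth projective surfaces and `γ ∈ H⁴(S × S';ℚ)` with `γ ⊗ 1 ∈ N²(S × S')` there
is a Hodge class `t ∈ Hdg²(H²S ⊗ H²S')` with `crossMap t ⊗ 1` algebraic and `(crossMap t ⊗ 1)_* = (γ ⊗ 1)_* : H²(S';ℂ) → H²(S;ℂ)`. [cite: VoisinHodgeI2002, §11.1.2 Prop. 11.20, §11.3.3 Thm. 11.38–11.40 and pp. 286–287]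
[cite: Voisin2025, §3.2.1 (12)–(14), Prop. 3.8 and Cor. 3.9] -/
theorem BettiUniverse.exists_kunneth_two_two_algebraic_corrAction_eq (hHD : exists_isReal_hodgeModel) (hS : IsSmoothProjective 2 S) (hS' : IsSmoothProjective 2 S') {γ : bettiCohomology (S ⊗ S') (2 * 2)}
    (hγ : ofRatClass (ComplexPoints (S ⊗ S')) (2 * 2) γ ∈ algebraicClasses (S ⊗ S') 2) :
    ∃ t ∈ (BettiUniverse.kunnethSummand hHD hS hS' (2 * 2) ⟨(2, 2), HasAntidiagonal.mem_antidiagonal.2 rfl⟩).hodgeClasses 2,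
      ofRatClass (ComplexPoints (S ⊗ S')) (2 * 2) (BettiUniverse.crossMap S S' (show 2 + 2 = 2 * 2 by norm_num) t) ∈ algebraicClasses (S ⊗ S') 2 ∧
      corrAction μ hS hS' (rfl : 2 + 2 * 2 = 2 + 2 * 2) (ofRatClass (ComplexPoints (S ⊗ S')) (2 * 2) (BettiUniverse.crossMap S S' (show 2 + 2 = 2 * 2 by norm_num) t)) =
        corrAction μ hS hS' (rfl : 2 + 2 * 2 = 2 + 2 * 2) (ofRatClass (ComplexPoints (S ⊗ S')) (2 * 2) γ) :=
  BettiUniverse.exists_kunneth_algebraic_corrAction_eq_of_forall_ne μ hHD hS hS' (show 2 + 2 = 2 * 2 by norm_num) rfl (BettiUniverse.kunneth_surfaces_ne_two_two_algebraic hHD hS hS') hγ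

/-- **`HC(S × S')` for two smooth projective surfaces IFF every Hodge class of `H²(S) ⊗ H²(S')` acts on `H²(S';ℂ)` as some rational algebraic class of `H⁴(S × S')` does** — any irregularities, any
geometric genera («the Hodge conjecture for `S × S'` is the algebraicity of the morphisms of Hodge structures `H²(S') → H²(S)`», Lemma 11.41). [cite: VoisinHodgeI2002, §11.3.3 Thm. 11.38–11.40, Lemma 11.41 and pp. 286–287]
[cite: Voisin2025, §3.2.1 (12)–(14), Prop. 3.8 and Cor. 3.9] [cite: Deligne2000, §1] -/
theorem BettiUniverse.hodgeConjectureFor_tensor_surfaces_iff_forall_exists_corrAction_eq (hHD : exists_isReal_hodgeModel) (hS : IsSmoothProjective 2 S) (hS' : IsSmoothProjective 2 S')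
    (hSS' : IsSmoothProjective 4 (S ⊗ S')) :
    HodgeConjectureFor 4 (S ⊗ S') ↔
      ∀ t ∈ (BettiUniverse.kunnethSummand hHD hS hS' (2 * 2) ⟨(2, 2), HasAntidiagonal.mem_antidiagonal.2 rfl⟩).hodgeClasses 2,
        ∃ γ : bettiCohomology (S ⊗ S') (2 * 2), ofRatClass (ComplexPoints (S ⊗ S')) (2 * 2) γ ∈ algebraicClasses (S ⊗ S') 2 ∧
          corrAction μ hS hS' (rfl : 2 + 2 * 2 = 2 + 2 * 2) (ofRatClass (ComplexPoints (S ⊗ S')) (2 * 2) γ) =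
            corrAction μ hS hS' (rfl : 2 + 2 * 2 = 2 + 2 * 2) (ofRatClass (ComplexPoints (S ⊗ S')) (2 * 2) (BettiUniverse.crossMap S S' (show 2 + 2 = 2 * 2 by norm_num) t)) := by
  rw [BettiUniverse.hodgeConjectureFor_tensor_surfaces_iff_kunneth_piece_two_two hHD hS hS' hSS']
  refine ⟨fun h t ht ↦ ⟨_, h t ht, rfl⟩, fun h t ht ↦ ?_⟩
  obtain ⟨γ, hγ, hact⟩ := h t ht
  exact BettiUniverse.ofRatClass_crossMap_mem_algebraicClasses_of_corrAction_eq_of_forall_ne μ hHD hS hS' (show 2 + 2 = 2 * 2 by norm_num) (show 2 + 2 = 2 * 2 by norm_num) rfl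
    (BettiUniverse.kunneth_surfaces_ne_two_two_algebraic hHD hS hS') hγ hact

/-- **NUMERIC CRITERION: `HC(S × S') ⟺ dim_ℚ Hom_HS(H²(S), H²(S')) ≤ dim_ℂ ⟨(γ ⊗ 1)_* : H²(S';ℂ) → H²(S;ℂ) | γ ∈ H⁴(S × S';ℚ), γ ⊗ 1 ∈ N²⟩`** for two smooth projective surfaces (Lemma 11.41: the Hodge classes of
`H²S ⊗ H²S'` are `dim_ℚ Hom_HS(H²S, H²S')` in number). [cite: VoisinHodgeI2002, §11.3.3 Thm. 11.38–11.40, Lemma 11.41 and pp. 286–287] [cite: Voisin2025, §3.2.1 (12)–(14), Prop. 3.8 and Cor. 3.9] [cite: Deligne2000, §1] -/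
theorem BettiUniverse.hodgeConjectureFor_tensor_surfaces_iff_finrank_hom_le_finrank_span (hHD : exists_isReal_hodgeModel) (hS : IsSmoothProjective 2 S) (hS' : IsSmoothProjective 2 S')
    (hSS' : IsSmoothProjective 4 (S ⊗ S')) :
    HodgeConjectureFor 4 (S ⊗ S') ↔
      Module.finrank ℚ (HodgeStructure.Hom (BettiUniverse.hodge hHD hS 2) (BettiUniverse.hodge hHD hS' 2)) ≤
        Module.finrank ℂ ↥(Submodule.span ℂ ((fun γ ↦ corrAction μ hS hS' (rfl : 2 + 2 * 2 = 2 + 2 * 2) (ofRatClass (ComplexPoints (S ⊗ S')) (2 * 2) γ)) ''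
          {γ : bettiCohomology (S ⊗ S') (2 * 2) | ofRatClass (ComplexPoints (S ⊗ S')) (2 * 2) γ ∈ algebraicClasses (S ⊗ S') 2})) := by
  rw [BettiUniverse.hodgeConjectureFor_tensor_surfaces_iff_kunneth_piece_two_two hHD hS hS' hSS', ← BettiUniverse.finrank_hodgeClasses_tensor_hodge_eq_finrank_hom hHD hS hS' 2]
  exact BettiUniverse.kunneth_piece_algebraic_iff_finrank_le_of_forall_ne μ hHD hS hS' (show 2 + 2 = 2 * 2 by norm_num) (show 2 + 2 = 2 * 2 by norm_num) rfl
    (BettiUniverse.kunneth_surfaces_ne_two_two_algebraic hHD hS hS')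

/-- **Family form: `HC(S × S')` from `|ι|` algebraic correspondences.**  For two smooth projective surfaces, rational classes `γ_k ∈ H⁴(S × S')`, `k ∈ ι`, with algebraic complexifications and ℂ-linearly
independent actions `H²(S';ℂ) → H²(S;ℂ)`, and `dim_ℚ Hom_HS(H²S, H²S') ≤ |ι|`, imply `HC(S × S')` (the seat's g29-#4 §3 was `ι = {divisor products, Δ}`, `dim End_HS(H²S) ≤ ρ² + 1`).
[cite: VoisinHodgeI2002, §11.3.3 Thm. 11.38–11.40, Lemma 11.41 and pp. 286–287] [cite: Voisin2025, §3.2.1 (12)–(14), Prop. 3.8 and Cor. 3.9] [cite: Deligne2000, §1] -/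
theorem BettiUniverse.hodgeConjectureFor_tensor_surfaces_of_linearIndependent_corrAction {ι : Type} [Fintype ι] (hHD : exists_isReal_hodgeModel) (hS : IsSmoothProjective 2 S)
    (hS' : IsSmoothProjective 2 S') (hSS' : IsSmoothProjective 4 (S ⊗ S')) (γ : ι → bettiCohomology (S ⊗ S') (2 * 2))
    (hγ : ∀ k, ofRatClass (ComplexPoints (S ⊗ S')) (2 * 2) (γ k) ∈ algebraicClasses (S ⊗ S') 2)
    (hind : LinearIndependent ℂ fun k ↦ corrAction μ hS hS' (rfl : 2 + 2 * 2 = 2 + 2 * 2) (ofRatClass (ComplexPoints (S ⊗ S')) (2 * 2) (γ k)))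
    (hHom : Module.finrank ℚ (HodgeStructure.Hom (BettiUniverse.hodge hHD hS 2) (BettiUniverse.hodge hHD hS' 2)) ≤ Fintype.card ι) : HodgeConjectureFor 4 (S ⊗ S') := by
  rw [BettiUniverse.hodgeConjectureFor_tensor_surfaces_iff_kunneth_piece_two_two hHD hS hS' hSS']
  refine BettiUniverse.kunneth_piece_algebraic_of_linearIndependent_corrAction_of_forall_ne μ hHD hS hS' (show 2 + 2 = 2 * 2 by norm_num) (show 2 + 2 = 2 * 2 by norm_num) rfl
    (BettiUniverse.kunneth_surfaces_ne_two_two_algebraic hHD hS hS') γ hγ hind ?_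
  rwa [BettiUniverse.finrank_hodgeClasses_tensor_hodge_eq_finrank_hom hHD hS hS' 2]

/-- **The square of a surface: `HC(S × S) ⟺ dim_ℚ End_HS(H²S) ≤ dim_ℂ ⟨actions on H²(S;ℂ) of the rational algebraic classes of H⁴(S × S)⟩`** — every smooth projective surface; «`End_HS(H²(S))` (equivalently
`End_HS(T(S))` beyond the Néron–Severi part) is generated by algebraic self-correspondences». [cite: VoisinHodgeI2002, §11.3.3 Thm. 11.38–11.40, Lemma 11.41 and pp. 286–287] [cite: Deligne2000, §1] -/
theorem BettiUniverse.hodgeConjectureFor_tensor_self_surface_iff_finrank_end_le_finrank_span (hHD : exists_isReal_hodgeModel) (hS : IsSmoothProjective 2 S) (hSS : IsSmoothProjective 4 (S ⊗ S)) :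
    HodgeConjectureFor 4 (S ⊗ S) ↔
      Module.finrank ℚ (HodgeStructure.Hom (BettiUniverse.hodge hHD hS 2) (BettiUniverse.hodge hHD hS 2)) ≤
        Module.finrank ℂ ↥(Submodule.span ℂ ((fun γ ↦ corrAction μ hS hS (rfl : 2 + 2 * 2 = 2 + 2 * 2) (ofRatClass (ComplexPoints (S ⊗ S)) (2 * 2) γ)) ''
          {γ : bettiCohomology (S ⊗ S) (2 * 2) | ofRatClass (ComplexPoints (S ⊗ S)) (2 * 2) γ ∈ algebraicClasses (S ⊗ S) 2})) :=
  BettiUniverse.hodgeConjectureFor_tensor_surfaces_iff_finrank_hom_le_finrank_span μ hHD hS hS hSS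

end Surfaces

/-! ### §3 Surface × threefold -/

section SurfaceThreefold

variable [HodgeTensorFacts.{0, 0}] (μ : OrientationFamily)

/-- **On `S × T` (surface × threefold) with `Hom_HS(H¹S, H³T(1)) = 0`, the pieces of `H⁴` other than `H²(S) ⊗ H²(T)` carry only algebraic Hodge classes**: `H⁰(S) ⊗ H⁴(T)` (`HC²(T)`, dimension `3`),
`H⁴(S) ⊗ H⁰(T)`, `H³(S) ⊗ H¹(T)` (g29-#1 §1) and `H¹(S) ⊗ H³(T)` (no Hodge classes at all, Lemma 11.41). [cite: VoisinHodgeI2002, §11.3.3 Thm. 11.38–11.40, Lemma 11.41 and p. 287, §6.2.3 Thm. 6.25, §11.3.1 Thm. 11.30]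
[cite: VoisinHodgeII2003, §9.2.4 Prop. 9.20] -/
theorem BettiUniverse.kunneth_surface_threefold_ne_two_two_algebraic_of_hom_one_three (hHD : exists_isReal_hodgeModel) (hS : IsSmoothProjective 2 S) (hT : IsSmoothProjective 3 T)
    (h13 : Subsingleton (HodgeStructure.Hom (BettiUniverse.hodge hHD hS 1) (((BettiUniverse.hodge hHD hT 3).tateTwist 1).cast (by norm_num)))) (i' j' : ℕ) (hij' : i' + j' = 2 * 2)
    (hne : (i', j') ≠ (2, 2)) :
    ∀ u ∈ (BettiUniverse.kunnethSummand hHD hS hT (2 * 2) ⟨(i', j'), HasAntidiagonal.mem_antidiagonal.2 hij'⟩).hodgeClasses 2,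
      ofRatClass (ComplexPoints (S ⊗ T)) (2 * 2) (BettiUniverse.crossMap S T hij' u) ∈ algebraicClasses (S ⊗ T) 2 := by
  intro u hu
  have hST : IsSmoothProjective 5 (S ⊗ T) := hS.tensor_holds hT
  have hHCS : HodgeConjectureFor 2 S := hodgeConjectureFor_of_dim_le_three_holds (by norm_num) hS
  have hHCT : HodgeConjectureFor 3 T := hodgeConjectureFor_of_dim_le_three_holds le_rfl hT
  have hi' : i' ≤ 4 := by omega
  interval_cases i'
  · obtain rfl : j' = 4 := by omega
    exact BettiUniverse.ofRatClass_crossMap_mem_algebraicClasses_of_fst_zero hHD hS hT hij'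
      (fun z hz ↦ hHCT.2 2 _ (isRationalClass_ofRatClass _) ((BettiUniverse.mem_hodgeClasses_hodge_iff_isOfHodgeType hHD hT 2 z).1 hz)) hu
  · obtain rfl : j' = 3 := by omega
    -- no Hodge class in `H¹(S) ⊗ H³(T)`
    have hbot := (BettiUniverse.hodgeClasses_tensor_hodge_eq_bot_iff_subsingleton_hom_tateTwist hHD hS hT 1 3 (s := 1) (by norm_num)).2 h13
    have hu' : u ∈ ((BettiUniverse.hodge hHD hS 1).tensor (BettiUniverse.hodge hHD hT 3)).hodgeClasses ((1 : ℕ) + 1 : ℤ) := by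
      rw [show ((1 : ℕ) + 1 : ℤ) = ((2 : ℕ) : ℤ) by norm_num]
      exact hu
    rw [hbot, Submodule.mem_bot] at hu'
    rw [hu', map_zero, map_zero]
    exact Submodule.zero_mem _
  · obtain rfl : j' = 2 := by omega
    exact absurd rfl hne
  · obtain rfl : j' = 1 := by omega
    exact BettiUniverse.ofRatClass_crossMap_mem_algebraicClasses_of_mem_hodgeClasses_three_one hHD hS hT hST hu
  · obtain rfl : j' = 0 := by omega
    exact BettiUniverse.ofRatClass_crossMap_mem_algebraicClasses_of_snd_zero hHD hS hT hij'
      (fun y hy ↦ hHCS.2 2 _ (isRationalClass_ofRatClass _) ((BettiUniverse.mem_hodgeClasses_hodge_iff_isOfHodgeType hHD hS 2 y).1 hy)) hu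

/-- **`HC(S × T) ⟺ dim_ℚ Hom_HS(H²(S), H²(T)) ≤ dim_ℂ ⟨actions H⁴(T;ℂ) → H²(S;ℂ) of the rational algebraic classes of H⁴(S × T)⟩`** for a smooth projective surface `S` and threefold `T` with
`Hom_HS(H¹S, H³T(1)) = 0` (the piece `H¹(S) ⊗ H³(T)` is then empty; `HC(S × T) ⟺` the pieces `(1,3)`, `(2,2)` of `H⁴`, g29-#1 §3). [cite: VoisinHodgeI2002, §11.3.3 Thm. 11.38–11.40, Lemma 11.41 and pp. 286–287]
[cite: Voisin2025, §3.2.1 (12)–(14), Prop. 3.8 and Cor. 3.9] [cite: Deligne2000, §1] -/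
theorem BettiUniverse.hodgeConjectureFor_surface_tensor_threefold_iff_finrank_hom_le_finrank_span_of_hom_one_three (hHD : exists_isReal_hodgeModel) (hS : IsSmoothProjective 2 S)
    (hT : IsSmoothProjective 3 T) (hST : IsSmoothProjective 5 (S ⊗ T))
    (h13 : Subsingleton (HodgeStructure.Hom (BettiUniverse.hodge hHD hS 1) (((BettiUniverse.hodge hHD hT 3).tateTwist 1).cast (by norm_num)))) :
    HodgeConjectureFor 5 (S ⊗ T) ↔
      Module.finrank ℚ (HodgeStructure.Hom (BettiUniverse.hodge hHD hS 2) (BettiUniverse.hodge hHD hT 2)) ≤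
        Module.finrank ℂ ↥(Submodule.span ℂ ((fun γ ↦ corrAction μ hS hT (rfl : 4 + 2 * 2 = 2 + 2 * 3) (ofRatClass (ComplexPoints (S ⊗ T)) (2 * 2) γ)) ''
          {γ : bettiCohomology (S ⊗ T) (2 * 2) | ofRatClass (ComplexPoints (S ⊗ T)) (2 * 2) γ ∈ algebraicClasses (S ⊗ T) 2})) := by
  have hother := BettiUniverse.kunneth_surface_threefold_ne_two_two_algebraic_of_hom_one_three hHD hS hT h13
  rw [← BettiUniverse.finrank_hodgeClasses_tensor_hodge_eq_finrank_hom hHD hS hT 2,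
    ← BettiUniverse.kunneth_piece_algebraic_iff_finrank_le_of_forall_ne μ hHD hS hT (show 2 + 2 = 2 * 2 by norm_num) (show 4 + 2 = 2 * 3 by norm_num) rfl hother]
  constructor
  · intro hHC t ht
    obtain ⟨γ, hγ, hact⟩ := BettiUniverse.forall_exists_corrAction_eq_of_hodgeConjectureFor_tensor μ hHD hS hT hST hHC (show 2 + 2 = 2 * 2 by norm_num) (rfl : 4 + 2 * 2 = 2 + 2 * 3) ht
    exact BettiUniverse.ofRatClass_crossMap_mem_algebraicClasses_of_corrAction_eq_of_forall_ne μ hHD hS hT (show 2 + 2 = 2 * 2 by norm_num) (show 4 + 2 = 2 * 3 by norm_num) rfl hother hγ hact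
  · intro h22
    refine BettiUniverse.hodgeConjectureFor_surface_tensor_threefold_of_kunneth_pieces_one_three_two_two hHD hS hT hST (fun t ht ↦ ?_) h22
    exact hother 1 3 rfl (by simp) t ht

end SurfaceThreefold

end Literature.AlgebraicGeometry.HodgeTheory

end
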